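import Literature.AlgebraicGeometry.Motives.HodgeStructurePontryaginProduct
import Literature.AlgebraicGeometry.Motives.HodgeStructureExteriorPowerComplexInvariants
import Literature.AlgebraicGeometry.Motives.HodgeStructurePushforwardPullbackDegree
import Literature.AlgebraicGeometry.Motives.MumfordTateDeterminantMultiplier
import HarnessLib

/-!
# Hodge classes are closed under the Pontryagin product: `x ∈ Hdg(⋀^{2a}H), y ∈ Hdg(⋀^{2b}H) ⟹ x ⋆ y ∈ Hdg(⋀^{2(a+b−g)}H)`,
# through Deligne's criterion "`t` Hodge ⟺ `g t = ν(g)ʲ t` for all `g ∈ MT(H)(ℚ)`" and `⋀γ (x ⋆ y) = (det γ)⁻¹ (⋀γ x ⋆ ⋀γ y)`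

[topic AlgebraicGeometry/Motives]

Layer `Literature/AlgebraicGeometry/Motives`, lane `lit-hodgefound` (Track 2 foundations library; prover seat `lit-hodgefound-p34`,
generation 35, row g35-#8). THEOREMS ONLY (no `def`, no named fact, no instance, no notation; net debt `0`). The HODGE-class companion of
row g35-#6 (`HodgeStructurePontryaginLefschetzClasses`: Milne's Lefschetz classes `ℚ[B¹(H)]` are closed under `⋆`, through `S(H)`); here
the Mumford–Tate group replaces `L(A)` and Deligne's twisted invariance replaces Milne's Cor. 4.5.

THE SETTING: `H` a polarizable `ℚ`-Hodge structure of odd weight `n` on `V ≠ 0` (`dim V = 2g`) with polarization `Q`, `E = E_Q`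
(`Q.isSymplectic_lefschetzClass hn hg`), `x ⋆ y = (Q.isSymplectic_lefschetzClass hn hg).pontryagin x y` the Pontryagin product of row g35-#2
on `H•(A) = ⋀_ℚ V`, `MT(H)(ℚ) = H.mumfordTateGroup ≤ GL(V)`, `ν = Q.multiplierCharRat : MT(H)(ℚ) → ℚˣ` the multiplier (`Q(gv, gw) =
ν(g) Q(v, w)`), `Hdgᵖ(⋀ᵏH) = (H.exteriorPower k).hodgeClasses p` (classes of type `(p, p)`, `2p = kn`).

## Sources, and how the printed proofs are followed

P. Deligne, *Hodge cycles on abelian varieties* (in LNM 900, 1982) [Deligne1982HodgeCycles], I §3 Prop. 3.4 and the definition of the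
Mumford–Tate group: "the elements of `MT` act on a Hodge class `t` of type `(p, p)` through `ν(g)ᵖ`", in the tree's form (row
`HodgeStructureExteriorPowerComplexInvariants`, seat p34 g9) `Polarization.mem_hodgeClasses_exteriorPower_iff_forall_map_eq_multiplierCharRat_zpow_smul`:
**`y ∈ Hdgᵖ(⋀ᵏH)` iff `⋀ᵏg y = ν(g)ʲ y` for all `g ∈ MT(H)(ℚ)`** (`p = nj`, `p + p = kn`). J. S. Milne, *Lefschetz classes on abelian
varieties* (1999) [Milne1999LefschetzClasses], §5 Prop. 5.4 (p. 663: `φ_*` commutes with the group actions) — here in the sharper form §1: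
**the Gysin map `μ_*` is `GL(W)`-equivariant up to the character `det⁻¹`** (Lange's `∫ f^*η = det ρ_r(f) ∫ η`, Cor. 1.7.6, row
`HodgeStructurePushforwardPullbackDegree` `trace_map_eq_det_mul`, on `X` and on `X × X`). Then for `g ∈ MT(H)(ℚ)`: `det g = ν(g)^g` (row
`MumfordTateDeterminantMultiplier`), so `⋀g (x ⋆ y) = ν^{−g} (ν^a x ⋆ ν^b y) = ν^{a+b−g} (x ⋆ y)` and Deligne's criterion concludes (the Mumford–Tate
vocabulary carries the instance hypothesis `[HodgeTensorFacts]` — the tree's convention, discharged by `hodgeTensorFacts_holds` of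
`Motives/HodgeTensorFactsHolds`). H. Lange,
*Abelian Varieties over the Complex Numbers* (2023) [Lange2023AbelianVarietiesComplex], §2.5.3 (p0132) and §6.2.3 (p0308) for `⋆`.

## What is PROVED

* §1 (every field `K` of characteristic `0`) **`IsSymplectic.map_pontryagin_eq_inv_det_smul`: `⋀γ (x ⋆ y) = (det γ)⁻¹ • (⋀γ x ⋆ ⋀γ y)` for
  EVERY `γ ∈ GL(W)`** (refines row g35-#6 `map_pontryagin`, the case `det γ = 1`).
* §2 `Polarization.map_coe_lefschetzClass_eq_multiplierCharRat_smul` (`⋀g E = ν(g) E` on `MT(H)(ℚ)`),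
  `Polarization.map_pontryagin_of_mem_mumfordTateGroup` (`⋀g (x ⋆ y) = ν(g)^{−g} (⋀g x ⋆ ⋀g y)`), and **`Polarization.pontryagin_mem_hodgeClasses`:
  `x ∈ Hdg^{na}(⋀^{2a}H)`, `y ∈ Hdg^{nb}(⋀^{2b}H)`, `a + b = g + c` ⟹ `x ⋆ y ∈ Hdg^{nc}(⋀^{2c}H)`** (and `x ⋆ y = 0` when `a + b < g`,
  `Polarization.pontryagin_eq_zero_of_add_lt`).

TWIN NOTICE (RULING 29 bis): the integral-torus carrier `AlgebraicGeometry/HodgeTheory/ComplexTorusIntegralHodgeClassesPontryaginRing` proves the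
Pontryagin ring of Hodge classes of a complex torus — other carrier, BY NAME, nothing imported or restated; the present statement is for an
abstract polarizable `ℚ`-HS of odd weight through the Mumford–Tate group.

## References

* [Deligne1982HodgeCycles] P. Deligne, *Hodge cycles on abelian varieties*, LNM 900 (1982), I §3 Prop. 3.4.
* [Milne1999LefschetzClasses] J. S. Milne, *Lefschetz classes on abelian varieties*, Duke Math. J. 96 (1999), §5 Prop. 5.4 (p. 663), §4 p. 665.
* [Lange2023AbelianVarietiesComplex] H. Lange, *Abelian Varieties over the Complex Numbers* (2023), §1.7 Cor. 1.7.6, §2.5.3, §6.2.3.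
* [BourbakiAlgebraI1989] N. Bourbaki, *Algebra I*, Ch. III §8 Prop. 10 (`⋀ⁿ(u) = det u`).
-/

noncomputable section

open scoped TensorProduct Nat

namespace Literature.AlgebraicGeometry.Motives

universe u

/-! ## §1 `μ_*` is `GL(W)`-equivariant up to `det⁻¹` -/

namespace ExteriorLefschetz

open ExteriorAlgebra

variable {K : Type*} [Field K] [CharZero K] {W : Type*} [AddCommGroup W] [Module K W] {ω : ExteriorAlgebra K W} {g : ℕ}

/-- **`⋀γ (x ⋆ y) = (det γ)⁻¹ • (⋀γ x ⋆ ⋀γ y)` for every `γ ∈ GL(W)`** — the Gysin map `μ_*` (defined through the orientations `τ_ω`,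
`τ_{ω ⊞ ω}`) is equivariant up to `det⁻¹`: pairing with `⋀γ z`, `τ(⋀γ(z ∧ (x ⋆ y))) = det γ · τ_{X×X}(μ^*z ∧ Φ(x ⊗ y))` while
`τ(⋀γ z ∧ (⋀γ x ⋆ ⋀γ y)) = τ_{X×X}(⋀(γ × γ)(μ^*z ∧ Φ(x ⊗ y))) = (det γ)² τ_{X×X}(μ^*z ∧ Φ(x ⊗ y))` ("`∫ f^*η = det ρ_r(f) ∫ η`",
`det(γ × γ) = (det γ)²`). [cite: Lange2023AbelianVarietiesComplex, §1.7 Cor. 1.7.6 (p. 73) with §1.1 Prop. 1.1.13 (c)] [cite: Milne1999LefschetzClasses, §5 Prop. 5.4 (p. 663)] -/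
theorem IsSymplectic.map_pontryagin_eq_inv_det_smul (hω : IsSymplectic ω g) (γ : W ≃ₗ[K] W) (x y : ExteriorAlgebra K W) :
    ExteriorAlgebra.map (γ : W →ₗ[K] W) (hω.pontryagin x y) =
      (LinearMap.det (γ : W →ₗ[K] W))⁻¹ • hω.pontryagin (ExteriorAlgebra.map (γ : W →ₗ[K] W) x) (ExteriorAlgebra.map (γ : W →ₗ[K] W) y) := by
  haveI := hω.finite
  have hdet : LinearMap.det (γ : W →ₗ[K] W) ≠ 0 := (LinearEquiv.isUnit_det' γ).ne_zero
  rw [eq_inv_smul_iff₀ hdet, ← sub_eq_zero]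
  refine hω.eq_zero_of_forall_trace_mul_eq_zero' fun z ↦ ?_
  obtain ⟨z, rfl⟩ := map_equiv_surjective γ z
  have hz : ExteriorAlgebra.map (LinearMap.id.prod LinearMap.id : W →ₗ[K] W × W) (ExteriorAlgebra.map (γ : W →ₗ[K] W) z) =
      ExteriorAlgebra.map ((γ : W →ₗ[K] W).prodMap (γ : W →ₗ[K] W)) (ExteriorAlgebra.map (LinearMap.id.prod LinearMap.id : W →ₗ[K] W × W) z) := by
    rw [← AlgHom.comp_apply, ← AlgHom.comp_apply, map_comp_map, map_comp_map]
    rfl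
  have hxy : kunnethEquiv K W W (ExteriorAlgebra.map (γ : W →ₗ[K] W) x ⊗ₜ[K] ExteriorAlgebra.map (γ : W →ₗ[K] W) y) =
      ExteriorAlgebra.map ((γ : W →ₗ[K] W).prodMap (γ : W →ₗ[K] W)) (kunnethEquiv K W W (x ⊗ₜ[K] y)) := by
    rw [map_prodMap_kunnethEquiv, TensorProduct.map_tmul, AlgHom.toLinearMap_apply, AlgHom.toLinearMap_apply]
  rw [mul_sub, map_sub, sub_eq_zero, mul_smul_comm, map_smul, smul_eq_mul, ← map_mul, trace_map_eq_det_mul, hω.trace_mul_pontryagin,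
    hω.trace_mul_pontryagin, kunnethEquiv_comul, kunnethEquiv_comul, hz, hxy, ← map_mul, trace_map_eq_det_mul, LinearMap.det_prodMap, mul_assoc]

end ExteriorLefschetz

/-! ## §2 On the polarized-`ℚ`-HS carrier: Hodge classes are closed under `⋆` -/

namespace HodgeStructure

open ExteriorLefschetz ExteriorAlgebra

variable {V : Type u} [AddCommGroup V] [Module ℚ V] [Module.Finite ℚ V] [Nontrivial V] [HodgeTensorFacts.{u, u}] {n : ℤ}
  {H : HodgeStructure V n} (Q : Polarization H) (hn : Odd n) {g : ℕ} (hg : Module.finrank ℚ V = 2 * g)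

/-- **`⋀g E = ν(g) E` for `g ∈ MT(H)(ℚ)`** (`E = E_Q ∈ Hdgⁿ(⋀²H)`, Deligne's criterion with `j = 1`). [cite: Deligne1982HodgeCycles, I §3 Prop. 3.4] -/
theorem Polarization.map_coe_lefschetzClass_eq_multiplierCharRat_smul (γ : H.mumfordTateGroup) :
    ExteriorAlgebra.map ((γ : V ≃ₗ[ℚ] V) : V →ₗ[ℚ] V) (Q.lefschetzClass : ExteriorAlgebra ℚ V) =
      ((Q.multiplierCharRat γ : ℚˣ) : ℚ) • (Q.lefschetzClass : ExteriorAlgebra ℚ V) := by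
  have h := (Q.mem_hodgeClasses_exteriorPower_iff_forall_map_eq_multiplierCharRat_zpow_smul 1 (p := n) (by ring) (by push_cast; ring)
    Q.lefschetzClass).1 Q.lefschetzClass_mem_hodgeClasses γ
  rw [zpow_one] at h
  have h' := congrArg Subtype.val h
  rwa [coe_exteriorPower_map, Submodule.coe_smul] at h'

include hn hg in
/-- **`⋀g (x ⋆ y) = ν(g)^{−g} • (⋀g x ⋆ ⋀g y)` for `g ∈ MT(H)(ℚ)`** (§1 and `det g = ν(g)^g`, row `MumfordTateDeterminantMultiplier`).
[cite: Deligne1982HodgeCycles, I §3 Prop. 3.4] [cite: Milne1999LefschetzClasses, §5 Prop. 5.4 (p. 663)] -/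
theorem Polarization.map_pontryagin_of_mem_mumfordTateGroup (γ : H.mumfordTateGroup) (x y : ExteriorAlgebra ℚ V) :
    ExteriorAlgebra.map ((γ : V ≃ₗ[ℚ] V) : V →ₗ[ℚ] V) ((Q.isSymplectic_lefschetzClass hn hg).pontryagin x y) =
      ((((Q.multiplierCharRat γ : ℚˣ) : ℚ) ^ g)⁻¹) •
        (Q.isSymplectic_lefschetzClass hn hg).pontryagin (ExteriorAlgebra.map ((γ : V ≃ₗ[ℚ] V) : V →ₗ[ℚ] V) x)
          (ExteriorAlgebra.map ((γ : V ≃ₗ[ℚ] V) : V →ₗ[ℚ] V) y) := by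
  rw [(Q.isSymplectic_lefschetzClass hn hg).map_pontryagin_eq_inv_det_smul,
    Q.det_eq_multiplierCharRat_pow_of_mem_mumfordTateGroup (k := g) (by omega) γ.2]

omit [Nontrivial V] [HodgeTensorFacts.{u, u}] in
include hn hg in
/-- `x ⋆ y = 0` for `x ∈ ⋀^{2a}`, `y ∈ ⋀^{2b}`, `a + b < g` (degrees). [cite: Lange2023AbelianVarietiesComplex, §2.5.3 (p0132)] -/
theorem Polarization.pontryagin_eq_zero_of_add_lt {a b : ℕ} (hab : a + b < g) (x : ⋀[ℚ]^(2 * a) V) (y : ⋀[ℚ]^(2 * b) V) :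
    (Q.isSymplectic_lefschetzClass hn hg).pontryagin (x : ExteriorAlgebra ℚ V) (y : ExteriorAlgebra ℚ V) = 0 :=
  (Q.isSymplectic_lefschetzClass hn hg).pontryagin_eq_zero_of_add_lt (by omega) x.2 y.2

include hn in
/-- **HODGE CLASSES ARE CLOSED UNDER THE PONTRYAGIN PRODUCT: for `x ∈ Hdg^{na}(⋀^{2a}H)`, `y ∈ Hdg^{nb}(⋀^{2b}H)` and `a + b = g + c`, the
class `x ⋆ y ∈ ⋀^{2c}V` lies in `Hdg^{nc}(⋀^{2c}H)`.** Proof (Deligne's criterion): for `g ∈ MT(H)(ℚ)`, `⋀g x = ν^a x`, `⋀g y = ν^b y`, hence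
`⋀g (x ⋆ y) = ν^{−g} ν^{a+b} (x ⋆ y) = ν^c (x ⋆ y)`. The Hodge-class analogue of Milne's Cor. 5.5 for the addition map `μ` ("`μ_*` preserves
Hodge classes"). [cite: Deligne1982HodgeCycles, I §3 Prop. 3.4] [cite: Milne1999LefschetzClasses, §5 Cor. 5.5 (p. 663) and §4 p. 665 (Hodge classes, Hg(A))] [cite: Lange2023AbelianVarietiesComplex, §6.2.3 (p0308)] -/
theorem Polarization.pontryagin_mem_hodgeClasses {a b c : ℕ} (habc : a + b = g + c) {x : ⋀[ℚ]^(2 * a) V} {y : ⋀[ℚ]^(2 * b) V}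
    (hx : x ∈ (H.exteriorPower (2 * a)).hodgeClasses (n * a)) (hy : y ∈ (H.exteriorPower (2 * b)).hodgeClasses (n * b)) :
    (⟨(Q.isSymplectic_lefschetzClass hn hg).pontryagin (x : ExteriorAlgebra ℚ V) (y : ExteriorAlgebra ℚ V),
        (Q.isSymplectic_lefschetzClass hn hg).pontryagin_mem (r := 2 * c) (by omega) x.2 y.2⟩ : ⋀[ℚ]^(2 * c) V) ∈
      (H.exteriorPower (2 * c)).hodgeClasses (n * c) := by
  have hx' := (Q.mem_hodgeClasses_exteriorPower_iff_forall_map_eq_multiplierCharRat_zpow_smul (a : ℤ) (p := n * a) rfl (by push_cast; ring) x).1 hx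
  have hy' := (Q.mem_hodgeClasses_exteriorPower_iff_forall_map_eq_multiplierCharRat_zpow_smul (b : ℤ) (p := n * b) rfl (by push_cast; ring) y).1 hy
  refine Q.mem_hodgeClasses_exteriorPower_of_forall_map_eq_multiplierCharRat_zpow_smul (c : ℤ) (p := n * c) rfl (by push_cast; ring) fun γ ↦ ?_
  refine Subtype.ext ?_
  have hxγ := congrArg Subtype.val (hx' γ)
  have hyγ := congrArg Subtype.val (hy' γ)
  rw [coe_exteriorPower_map, Submodule.coe_smul, zpow_natCast] at hxγ hyγ
  have hν : (((Q.multiplierCharRat γ : ℚˣ) : ℚ)) ≠ 0 := (Q.multiplierCharRat γ).ne_zero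
  rw [coe_exteriorPower_map, Submodule.coe_smul, zpow_natCast]
  change ExteriorAlgebra.map ((γ : V ≃ₗ[ℚ] V) : V →ₗ[ℚ] V)
      ((Q.isSymplectic_lefschetzClass hn hg).pontryagin (x : ExteriorAlgebra ℚ V) (y : ExteriorAlgebra ℚ V)) =
    (((Q.multiplierCharRat γ : ℚˣ) : ℚ) ^ c) • (Q.isSymplectic_lefschetzClass hn hg).pontryagin (x : ExteriorAlgebra ℚ V) (y : ExteriorAlgebra ℚ V)
  rw [Q.map_pontryagin_of_mem_mumfordTateGroup hn hg, hxγ, hyγ, map_smul, map_smul, LinearMap.smul_apply, smul_smul, smul_smul, mul_assoc,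
    ← pow_add, show b + a = g + c by omega, pow_add, ← mul_assoc, inv_mul_cancel₀ (pow_ne_zero g hν), one_mul]

end HodgeStructure

end Literature.AlgebraicGeometry.Motives
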